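import Summits.ValiantsHypothesis.ValiantsHypothesis.Theorems.NewtonUnitEquationsTwoProductsRankOneOneSidedLawShiftPlanar
import Summits.ValiantsHypothesis.ValiantsHypothesis.Theorems.NewtonUnitEquationsTwoProductsRankOneSimplexCount
import HarnessLib

/-!
# Route NewtonUnitEquations — crux `TwoProducts` (stmt-ValiantsHypothesis-5906), line `relation_ladder`, rung R8 (ONE-SIDED rank one
# `p•α = Σ_i q_i•β_i`, any number of plus letters): the DILATED FREE LIFT with a plus-letter SET — part 5/6 — per visible point a strict pencil minimiser; slices through the simplex; the fibrewise count (T8)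

Part 5: `xOf_congr`, `sB_piT_le` (plus mass `≤ m²(m+1)`), **`card_le_of_supported`** (`#{f supported on T, Σ_T f ≤ n} ≤ 2^{n+#T}` through
`R8.card_W_le`), `NmO`, `sliceBdO`, **`RelDataO.sliceMin_of_visible`**, `RelDataO.sliceCount` (`ShiftRank.pencilCount` BY NAME),
**`RelDataO.count`**: `#S ≤ 2^{2m+2} · sliceBdO m s`.

THE ONE-SIDED RANK-ONE LAW `p•α = Σ_{i<k} q_i•β_i` (R8; all `p, q_i ≥ 1`, distinct letters, every additive coincidence of the letter
family a multiple of this one relation): GLOBALLY `#visible ≤ 2^{c m}(#T + 2)^c` (`c = 1732`).  Engine (val-idea-8 g3's memo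
`Cruxes/TwoProducts/Lines/relation_ladder_R8_engine.md` rev 2, typed target `Lines/relation_ladder_sketch_R8.lean :: R8.RankOneOneSidedLaw`,
slice count `Lines/relation_ladder_R8_simplex.lean` = landed `…RankOneSimplexCount`): the DILATED FREE LIFT `α ↦ ∏ Y_j^{q_j}`, `Y_j ↦ Y_j^p` on
the plus letters, identity elsewhere, over the `p`-dilated plane (`enumP : j ↦ enum j` on the plus letters, `i ↦ p•enum i` otherwise); fibres
`k = #α` with divisibility guards `p ∣ x_j − q_j k`; letter count `B_k = k + Σ_j (x_j − q_j k)/p`; SLICING by the whole plus-letter exponent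
vector `b = x|_B`; the coefficient theorem with `Pfac · C(R + B_k − 1, B_k) · κ_k`; finite SHIFT RANK `2m(Σb + 1)² + 1` and val-lit-p3's
`ShiftRank.pencilCount` BY NAME; the slices of the visible points factor through the restricted letter multisets `L₀|_{a ∪ B}` (`deg L₀ ≤ m`),
counted by the simplex bound `#W ≤ 2^{n+k}` (`R8.card_W_le`); WIDE plus sides (`k > m + 1`), large (`> m`) or absent coefficients/letters are
permutation type (R3♯).  `k = 1` is R7c (`R7b.rankOneTwoLaw_proof`), `k = 2` is R7b (`R7b.rankOneThreeGenLaw_proof`).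

AUTHORSHIP / LANE NOTE (val-lit-p3 g15, prover seat, helper mode `--supports stmt-ValiantsHypothesis-5906 --as helper`; CLAIM-FIRST #2 on the
val-lit bus 12:55Z, silence = GO 13:30Z, no objection; the line owner val-idea-8 g3 CLOSED 12:24Z leaving R8 as a typed target + memo): part 5/6.
The STATEMENT is val-idea-8 g3's typed `R8.RankOneOneSidedLaw` (landed here by its LITERAL BODY, `OneSidedRankOne` unfolded — parameter-free
`def … : Prop` are not declared in Theorems files); the engine follows g3's memo decl-by-decl as a generalisation of the landed R7b REV 2 port
(`…RankOneThreeGenLaw*`, namespace `R7b`); the Lean text of this module is this seat's.  Reused BY NAME: `R6b.HSD` (+ closure lemmas),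
`R7b.dilE`/`R7b.piT_dilE`/`R7b.piE_dilE`, `R7a.permType_of_rankOne_largeCoeff/absent`, `toolBound_mono`, `tab`, `sgn`, `R6b.sum_sgn`,
`PlanarCell.eq_of_nsmul_eq`, `FormalLogLinearisation.wt_nsmul`, `R8.card_W_le` (simplex).  Namespace `…PermutationType.R8` (the typed target's).
Nothing here closes the line's residual (`ResidualLawV20`), the crux `TwoProducts` (5906) or `VP ≠ VNP`; no summit statement is proved.

Honest scope: TWO-SIDED relations with ≥ 2 letters on each side (e.g. `α+2β = γ+δ`, val-neg-1 g4's p635912) and coincidence rank ≥ 2 are NOT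
covered.  Nothing here moves VP ≠ VNP; `TwoProducts` (5906) / `PlanarCellBound` stay OPEN. [folklore]
-/

noncomputable section

-- Sub = Summit single-conjunct layout: the duplicated namespace component is mandated by the tree.
set_option linter.dupNamespace false
set_option linter.unusedSimpArgs false
set_option linter.unusedSectionVars false
set_option linter.unusedVariables false

namespace Summit.ValiantsHypothesis.ValiantsHypothesis.Theorems.NewtonUnitEquations.TwoProducts.PermutationType
namespace R8
open scoped BigOperators
open MvPolynomial

variable {σ : Type*} [Fintype σ] [DecidableEq σ]

variable (Io : OIdx σ)
/-! ## Part T8: per visible point a zero-avoiding strict pencil-minimiser of a slice function (with a letter multiset of degree `≤ m`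
over it); slices counted through the simplex of restricted letter multisets; the fibrewise count via val-lit-p3's `ShiftRank.pencilCount` -/

section FreeCount
open Summit.ValiantsHypothesis.ValiantsHypothesis.Theorems.NewtonUnitEquations.TwoProducts.FormalLogLinearisation
open Summit.ValiantsHypothesis.ValiantsHypothesis.Theorems.NewtonUnitEquations.TwoProducts.PlanarCell

/-- `xOf b ν` reads `b` only on the plus letters. [folklore] -/
theorem xOf_congr {b b' : σ → ℕ} (h : ∀ j ∈ B Io, b j = b' j) (ν : σ → ℕ) : xOf Io b ν = xOf Io b' ν := by
  ext j
  unfold xOf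
  rw [ofFun_apply, ofFun_apply]
  by_cases hja : j = Io.a
  · rw [if_pos hja, if_pos hja]
  rw [if_neg hja, if_neg hja]
  by_cases hq : Io.qf j ≠ 0
  · rw [if_pos hq, if_pos hq, h j ((mem_B Io j).2 hq)]
  · rw [if_neg hq, if_neg hq]

/-- The plus mass of the toric image of a letter multiset of degree `≤ m` (coefficients `≤ m`, at most `m + 1` plus letters) is
`≤ m² (m + 1)`. [folklore] -/
theorem sB_piT_le {m : ℕ} (hq : ∀ j, Io.qf j ≤ m) (hp : Io.p ≤ m) (hB : (B Io).card ≤ m + 1) (L : σ →₀ ℕ)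
    (hL : deg L ≤ m) : sB Io ⇑(piT (frM Io) L) ≤ m * m * (m + 1) := by
  classical
  have hsum : L Io.a + ∑ j ∈ B Io, L j ≤ m := by
    have h := deg_eq_sum L
    rw [sum_split Io] at h
    omega
  have hqs : ∑ j ∈ B Io, Io.qf j ≤ (m + 1) * m :=
    calc ∑ j ∈ B Io, Io.qf j ≤ ∑ _j ∈ B Io, m := Finset.sum_le_sum fun j _ => hq j
      _ = (B Io).card * m := by rw [Finset.sum_const, smul_eq_mul]
      _ ≤ (m + 1) * m := Nat.mul_le_mul_right _ hB
  have hpm : Io.p ≤ (m + 1) * m := hp.trans (Nat.le_mul_of_pos_left m (by omega))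
  unfold sB
  have hcoord : ∀ j ∈ B Io, (piT (frM Io) L) j = Io.qf j * L Io.a + Io.p * L j := fun j hj => piT_frM_B Io L hj
  rw [Finset.sum_congr rfl hcoord, Finset.sum_add_distrib, ← Finset.sum_mul, ← Finset.mul_sum]
  have h1 : (∑ j ∈ B Io, Io.qf j) * L Io.a ≤ (m + 1) * m * L Io.a := Nat.mul_le_mul_right _ hqs
  have h2 : Io.p * ∑ j ∈ B Io, L j ≤ (m + 1) * m * ∑ j ∈ B Io, L j := Nat.mul_le_mul_right _ hpm
  calc (∑ j ∈ B Io, Io.qf j) * L Io.a + Io.p * ∑ j ∈ B Io, L j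
      ≤ (m + 1) * m * L Io.a + (m + 1) * m * ∑ j ∈ B Io, L j := Nat.add_le_add h1 h2
    _ = (m + 1) * m * (L Io.a + ∑ j ∈ B Io, L j) := by ring
    _ ≤ (m + 1) * m * m := Nat.mul_le_mul_left _ hsum
    _ = m * m * (m + 1) := by ring

omit [Fintype σ] in
/-- **Supported simplex count**: functions `σ → ℕ` vanishing off `T` with `Σ_T f ≤ n` number at most `2^(n + #T)` (through `W #T n`). [folklore] -/
theorem card_le_of_supported (T : Finset σ) (n : ℕ) (F : Finset (σ → ℕ))
    (hF : ∀ f ∈ F, (∀ j, j ∉ T → f j = 0) ∧ ∑ j ∈ T, f j ≤ n) : F.card ≤ 2 ^ (n + T.card) := by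
  classical
  set e := T.equivFin with he
  set φ : (σ → ℕ) → (Fin T.card → ℕ) := fun f i => f (e.symm i : ↥T) with hφ
  have hmaps : ∀ f ∈ F, φ f ∈ W T.card n := by
    intro f hf
    rw [mem_W]
    have h1 : ∑ i, φ f i = ∑ x : ↥T, f x := by
      rw [hφ]
      exact Fintype.sum_equiv e.symm (fun i => f (e.symm i : ↥T)) (fun x => f x) fun i => rfl
    rw [h1, Finset.sum_coe_sort T (fun j => f j)]
    exact (hF f hf).2
  have hinj : Set.InjOn φ ↑F := by
    intro f hf g hg hfg
    funext j
    by_cases hj : j ∈ T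
    · have := congrFun hfg (e ⟨j, hj⟩)
      simpa [hφ] using this
    · rw [(hF f hf).1 j hj, (hF g hg).1 j hj]
  calc F.card ≤ (W T.card n).card := Finset.card_le_card_of_injOn φ hmaps hinj
    _ ≤ 2 ^ (n + T.card) := card_W_le _ _

/-- The uniform width surrogate `N_m = 2 m (m²(m+1) + 1)^2 + 1 ≥ |SIdx m s|` (`s ≤ m²(m+1)`). [folklore] -/
def NmO (m : ℕ) : ℕ := 2 * m * (m * m * (m + 1) + 1) ^ 2 + 1

/-- The slice bound, uniform in the plus mass `≤ m²(m+1)`. [folklore] -/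
def sliceBdO (m s : ℕ) : ℕ := (s + 2) ^ 3 * (NmO m + 2) ^ (3 * (Nat.log 2 (NmO m + 2) + 1))

variable {m : ℕ} {u v : Fin m → MvPolynomial (Fin 2) ℂ} (Do : RelDataO u v)

/-- **Per visible point.** A visible point `l` (valid `ξ`) yields a toric point `x₀` over `p · l` (`x₀(a) = 0`), the image of a letter
multiset of degree `≤ m`, whose reduced exponent `x̂₀` is a zero-avoiding STRICT minimiser of the letter-weight functional on
`{ν : F_{x₀|B}(ν) ≠ 0}` over ALL of `ℕ^s`. [folklore] -/
theorem RelDataO.sliceMin_of_visible (hinj : Set.InjOn (piE Do.enumP) ↑Do.GT.support) (ξ : Fin 2 → ℝ)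
    (hval : ValidWeight u v ξ) (l : Expo) (htop : IsStrictTop ξ ↑(tailDiff u v).support l) :
    ∃ x₀ : Fin (sE u v) →₀ ℕ, piE Do.enumP x₀ = Do.p • l ∧ x₀ Do.idx.a = 0 ∧
      (∃ L₀ : Fin (sE u v) →₀ ℕ, deg L₀ ≤ m ∧ piT (frM Do.idx) L₀ = x₀) ∧
      Fsl Do.idx (cU u v) (cV u v) ⇑x₀ ⇑(xhat Do.idx x₀) ≠ 0 ∧
      ∀ ν : Fin (sE u v) → ℕ, ν ≠ ⇑(xhat Do.idx x₀) → Fsl Do.idx (cU u v) (cV u v) ⇑x₀ ν ≠ 0 →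
        ∑ i, Do.rWP ξ i * ((xhat Do.idx x₀ i : ℕ) : ℝ) < ∑ i, Do.rWP ξ i * (ν i : ℝ) := by
  classical
  obtain ⟨x₀, hx₀, hπ, hmin⟩ := Do.lifted_of_visible hinj ξ l htop
  obtain ⟨L₀, hL₀, hx₀L⟩ := Do.exists_of_mem_support_GT x₀ hx₀
  have hx₀a : x₀ Do.idx.a = 0 := Do.apply_a_of_mem_support_GT x₀ hx₀
  have hdegL : deg L₀ ≤ m := deg_le_of_mem_support_liftG _ _ L₀ hL₀
  -- the upstairs weights and their normalisation
  set θ : Fin (sE u v) → ℝ := Do.rWP ξ with hθdef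
  have hθpos : ∀ i, 0 < θ i := Do.rWP_pos ξ hval
  have hne : (Finset.univ : Finset (Fin (sE u v))).Nonempty := ⟨Do.idx.a, Finset.mem_univ _⟩
  set θmin : ℝ := Finset.univ.inf' hne θ with hθmin
  have hθmin_pos : 0 < θmin := by
    obtain ⟨i, -, hi⟩ := Finset.exists_mem_eq_inf' hne θ
    rw [hθmin, hi]; exact hθpos i
  have hθmin_le : ∀ i, θmin ≤ θ i := fun i => Finset.inf'_le θ (Finset.mem_univ i)
  set θ' : Fin (sE u v) → ℝ := fun i => θ i / θmin with hθ'
  have hθ'1 : ∀ i, 1 ≤ θ' i := fun i => by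
    rw [hθ']; simp only; rw [le_div_iff₀ hθmin_pos, one_mul]; exact hθmin_le i
  have hlwt' : ∀ x : Fin (sE u v) →₀ ℕ, lwt θ' x = lwt θ x / θmin := fun x => by
    unfold lwt; rw [Finset.sum_div]
    refine Finset.sum_congr rfl fun i _ => ?_
    rw [hθ']; ring
  have hlwtG : ∀ x ∈ Do.GT.support, lwt θ x = -wt ξ (piE Do.enumP x) := fun x _ => Do.lwt_rWP ξ x
  have hminθ' : x₀ ∈ (phiT (frM Do.idx) (liftG (cU u v) (cV u v))).support ∧
      ∀ x ∈ (phiT (frM Do.idx) (liftG (cU u v) (cV u v))).support, x ≠ x₀ → lwt θ' x₀ < lwt θ' x := by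
    refine ⟨hx₀, fun x hx hne' => ?_⟩
    rw [hlwt', hlwt']
    apply div_lt_div_of_pos_right _ hθmin_pos
    rw [hlwtG x₀ hx₀, hlwtG x hx, hπ]
    linarith [hmin x hx hne']
  have hA := toric_minLog (frM Do.idx) (frM_ne_zero Do.idx) θ' hθ'1 (cU u v) (cV u v) x₀ hminθ'
  set R : ℕ := ⌊lwt θ' x₀⌋₊ + 1 with hRdef
  have hRlt : lwt θ' x₀ < R := by rw [hRdef]; push_cast; exact Nat.lt_floor_add_one _
  -- `x₀ ≠ 0` and `deg x₀ ≤ R`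
  have hx₀ne : x₀ ≠ 0 := by
    intro h0
    have := mem_support_iff.mp hx₀
    apply this
    rw [h0]
    unfold RelDataO.GT
    rw [phiT_liftG, coeff_sub,
      coeff_zero_prod_eq_one _ (fun j => coeff_zero_one_add_phiT_lin (frM Do.idx) (frM_ne_zero Do.idx) _),
      coeff_zero_prod_eq_one _ (fun j => coeff_zero_one_add_phiT_lin (frM Do.idx) (frM_ne_zero Do.idx) _), sub_self]
  have hdegR : deg x₀ ≤ R := by
    have h2 : (deg x₀ : ℝ) ≤ lwt θ' x₀ := deg_le_lwt θ' hθ'1 x₀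
    have h3 : (deg x₀ : ℝ) < R := lt_of_le_of_lt h2 hRlt
    have h4 : deg x₀ < R := by exact_mod_cast h3
    omega
  have hF0 : Fsl Do.idx (cU u v) (cV u v) ⇑x₀ ⇑(xhat Do.idx x₀) ≠ 0 :=
    (mem_support_free_logTrunc_iff Do.idx (cU u v) (cV u v) R x₀ hx₀a hx₀ne hdegR).mp hA.1
  refine ⟨x₀, hπ, hx₀a, ⟨L₀, hdegL, hx₀L⟩, hF0, fun ν hν hFν => ?_⟩
  obtain ⟨hνa, hνB⟩ := shape_of_Fsl_ne_zero Do.idx (cU u v) (cV u v) _ ν hFν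
  set x' : Fin (sE u v) →₀ ℕ := xOf Do.idx ⇑x₀ ν with hx'def
  have hx'a : x' Do.idx.a = 0 := xOf_a Do.idx _ ν
  have hxh' : ⇑(xhat Do.idx x') = ν := xhat_xOf Do.idx _ ν hνa hνB
  have hx'B : ∀ j ∈ B Do.idx, x' j = x₀ j := fun j hj => xOf_B Do.idx _ ν hj
  have hFx' : Fsl Do.idx (cU u v) (cV u v) ⇑x' = Fsl Do.idx (cU u v) (cV u v) ⇑x₀ :=
    Fsl_congr Do.idx (cU u v) (cV u v) hx'B
  have hne' : x' ≠ x₀ := by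
    intro h; apply hν; rw [← hxh', h]
  have hx'ne : x' ≠ 0 := by
    intro hz
    have hνz : ∀ j, ν j = 0 := fun j => by rw [← hxh', hz]; simp [xhat]
    have hb0 : sB Do.idx ⇑x₀ = 0 :=
      Finset.sum_eq_zero fun j hj => by rw [← hx'B j hj, hz]; rfl
    exact hFν (Fsl_zero_zero Do.idx (cU u v) (cV u v) _ hb0 ν hνz)
  have hlt' : lwt θ' x₀ < lwt θ' x' := by
    by_cases hR' : deg x' ≤ R
    · have hmem : x' ∈ (phiT (frM Do.idx) (logTrunc (cU u v) (cV u v) R)).support :=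
        (mem_support_free_logTrunc_iff Do.idx (cU u v) (cV u v) R x' hx'a hx'ne hR').mpr
          (by rw [hFx', hxh']; exact hFν)
      exact hA.2 x' hmem hne'
    · push Not at hR'
      have h2 : (deg x' : ℝ) ≤ lwt θ' x' := deg_le_lwt θ' hθ'1 x'
      have h3 : (R : ℝ) < deg x' := by exact_mod_cast hR'
      linarith
  have hlt : lwt θ x₀ < lwt θ x' := by
    have := hlt'
    rw [hlwt', hlwt'] at this
    exact (div_lt_div_iff_of_pos_right hθmin_pos).mp this
  have hBsum : ∑ j ∈ B Do.idx, θ j * ((x' j : ℕ) : ℝ) = ∑ j ∈ B Do.idx, θ j * ((x₀ j : ℕ) : ℝ) :=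
    Finset.sum_congr rfl fun j hj => by rw [hx'B j hj]
  rw [lwt_splitO Do.idx θ x₀ hx₀a, lwt_splitO Do.idx θ x' hx'a, hBsum, hxh'] at hlt
  linarith

/-- **The per-slice count** from finite shift rank (val-lit-p3's `ShiftRank.pencilCount`, BY NAME). [folklore] -/
theorem RelDataO.sliceCount (b : Fin (sE u v) → ℕ) (hb : sB Do.idx b ≤ m * m * (m + 1)) (U V : Fin (sE u v) → ℝ)
    (Sb : Finset (Fin (sE u v) → ℕ))
    (hhyp : ∀ μ ∈ Sb, Fsl Do.idx (cU u v) (cV u v) b μ ≠ 0 ∧ ∃ t : ℝ, ∀ ν : Fin (sE u v) → ℕ, ν ≠ μ →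
      Fsl Do.idx (cU u v) (cV u v) b ν ≠ 0 → ∑ i, (U i + t * V i) * (μ i : ℝ) < ∑ i, (U i + t * V i) * (ν i : ℝ)) :
    Sb.card ≤ sliceBdO m (sE u v) := by
  obtain ⟨col, ch, hF⟩ := Fsl_shift Do.idx (cU u v) (cV u v) b
  have h1 := ShiftRank.pencilCount hF U V Sb hhyp
  rw [card_SIdx] at h1
  have h2 := BinExpSum.pencilCount_arith (sE u v) (2 * m * (sB Do.idx b + 1) ^ 2 + 1)
  have h3 : 2 * m * (sB Do.idx b + 1) ^ 2 + 1 ≤ NmO m :=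
    Nat.add_le_add_right (Nat.mul_le_mul_left _ (Nat.pow_le_pow_left (by omega) 2)) 1
  exact h1.trans (h2.trans (toolBound_mono (sE u v) 3 h3))

/-- **The count for a non-degenerate one-sided relation** (all letters in the alphabet, coefficients `≤ m`, at most `m + 1` plus
letters): `#S ≤ 2^{2m+2} · sliceBdO m s` (slices through the simplex of restricted letter multisets, fibres by the pencil count). [folklore] -/
theorem RelDataO.count (hu : ∀ j, coeff 0 (u j) = 0) (hv : ∀ j, coeff 0 (v j) = 0) (hqm : ∀ j, Do.qI j ≤ m)
    (hpm : Do.p ≤ m) (hBm : (B Do.idx).card ≤ m + 1)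
    (hR : RankOneCoincidences (fun j => (u j).support ∪ (v j).support) Do.rhoP (Finsupp.single Do.α Do.p))
    (S : Finset Expo) (hS : ∀ l ∈ S, ∃ ξ : Fin 2 → ℝ, ValidWeight u v ξ ∧ IsStrictTop ξ ↑(tailDiff u v).support l) :
    S.card ≤ 2 ^ (2 * m + 2) * sliceBdO m (sE u v) := by
  classical
  rcases S.eq_empty_or_nonempty with hSe | hSne
  · simp [hSe]
  obtain ⟨l₀, hl₀⟩ := hSne
  obtain ⟨ξ₀, hval₀, htop₀⟩ := hS l₀ hl₀
  have hTne : (tailSupport u v).Nonempty := tailSupport_nonempty_of_mem u v l₀ htop₀.1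
  have hsE : 0 < sE u v := Finset.card_pos.mpr hTne
  set e₀ : Expo := enum u v ⟨0, hsE⟩ with he₀def
  have he₀ : e₀ ≠ 0 := enum_ne_zero u v hu hv _
  obtain ⟨β, τ, hpencil⟩ := pencil_param e₀ he₀
  have hinj := Do.injOn_of_rankOne hu hv hR
  -- choices along `S`
  have hξ : ∀ x : ↥S, ∃ ξ : Fin 2 → ℝ, ValidWeight u v ξ ∧ IsStrictTop ξ ↑(tailDiff u v).support x.1 :=
    fun x => hS x.1 x.2
  choose ξf hξval hξtop using hξ
  have hpt := fun x : ↥S => Do.sliceMin_of_visible hinj (ξf x) (hξval x) x.1 (hξtop x)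
  choose xf hxπ hxa hxL hxF hxmin using hpt
  choose Lf hLdeg hLpi using hxL
  -- normalisation radii and the pencil parameter
  have hrpos : ∀ x : ↥S, 0 < -wt (ξf x) e₀ := fun x => by
    linarith [wt_enum_neg u v (ξf x) (hξval x) ⟨0, hsE⟩]
  have hnorm : ∀ x : ↥S, wt (fun k => ξf x k / (-wt (ξf x) e₀)) e₀ = -1 := fun x => by
    rw [wt_weight_div]
    have hne : wt (ξf x) e₀ ≠ 0 := by linarith [hrpos x]
    rw [div_neg, div_self hne]
  have hc : ∀ x : ↥S, ∃ c : ℝ, ∀ e : Expo, wt (fun k => ξf x k / (-wt (ξf x) e₀)) e = wt β e + c * wt τ e :=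
    fun x => hpencil _ (hnorm x)
  choose cf hcf using hc
  set U : Fin (sE u v) → ℝ := fun i => -wt β (Do.enumP i) with hU
  set V : Fin (sE u v) → ℝ := fun i => -wt τ (Do.enumP i) with hV
  have hUV : ∀ (x : ↥S) (i : Fin (sE u v)),
      U i + cf x * V i = Do.rWP (ξf x) i / (-wt (ξf x) e₀) := fun x i => by
    have h := hcf x (Do.enumP i)
    rw [wt_weight_div] at h
    rw [hU, hV]
    unfold RelDataO.rWP
    simp only
    rw [neg_div, h]
    ring
  have hsumUV : ∀ (x : ↥S) (ν : Fin (sE u v) → ℕ), ∑ i, (U i + cf x * V i) * (ν i : ℝ) =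
      (∑ i, Do.rWP (ξf x) i * (ν i : ℝ)) / (-wt (ξf x) e₀) := fun x ν => by
    rw [Finset.sum_div]
    refine Finset.sum_congr rfl fun i _ => ?_
    rw [hUV x i]
    ring
  -- the map `l ↦ x₀` is injective
  have hinjK : Function.Injective xf := by
    intro x y h
    apply Subtype.ext
    exact PlanarCell.eq_of_nsmul_eq Do.hp (by rw [← hxπ x, ← hxπ y, h])
  set Img : Finset (Fin (sE u v) →₀ ℕ) := (Finset.univ : Finset ↥S).image xf with hImg
  have hcard : Img.card = S.card := by
    rw [hImg, Finset.card_image_of_injective _ hinjK, Finset.card_univ, Fintype.card_coe]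
  -- the slice of a toric point: its restriction to the plus letters
  set slc : (Fin (sE u v) →₀ ℕ) → (Fin (sE u v) → ℕ) := fun x j => if j ∈ B Do.idx then x j else 0 with hslc
  have hslcB : ∀ (x : Fin (sE u v) →₀ ℕ), ∀ j ∈ B Do.idx, x j = slc x j := fun x j hj => by
    rw [hslc]; simp only; rw [if_pos hj]
  -- the number of slices, through the restricted letter multisets
  set T : Finset (Fin (sE u v)) := insert Do.idx.a (B Do.idx) with hT
  set Lr : ↥S → (Fin (sE u v) → ℕ) := fun x j => if j ∈ T then Lf x j else 0 with hLr
  set G : (Fin (sE u v) → ℕ) → (Fin (sE u v) → ℕ) :=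
    fun f j => if j ∈ B Do.idx then Do.idx.qf j * f Do.idx.a + Do.idx.p * f j else 0 with hG
  have hslcG : ∀ x : ↥S, slc (xf x) = G (Lr x) := by
    intro x
    funext j
    rw [hslc, hG]
    simp only
    by_cases hj : j ∈ B Do.idx
    · rw [if_pos hj, if_pos hj, hLr]
      simp only
      rw [if_pos (show Do.idx.a ∈ T by rw [hT]; exact Finset.mem_insert_self _ _),
        if_pos (show j ∈ T by rw [hT]; exact Finset.mem_insert_of_mem hj), ← hLpi x, piT_frM_B Do.idx _ hj]
    · rw [if_neg hj, if_neg hj]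
  have hTcard : T.card ≤ m + 2 := by
    rw [hT]
    exact (Finset.card_insert_le _ _).trans (by omega)
  have hLrF : ∀ f ∈ (Finset.univ : Finset ↥S).image Lr, (∀ j, j ∉ T → f j = 0) ∧ ∑ j ∈ T, f j ≤ m := by
    intro f hf
    obtain ⟨x, -, rfl⟩ := Finset.mem_image.mp hf
    refine ⟨fun j hj => by rw [hLr]; simp only; rw [if_neg hj], ?_⟩
    calc ∑ j ∈ T, Lr x j = ∑ j ∈ T, Lf x j :=
          Finset.sum_congr rfl fun j hj => by rw [hLr]; simp only; rw [if_pos hj]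
      _ ≤ ∑ j, Lf x j := Finset.sum_le_sum_of_subset_of_nonneg (Finset.subset_univ T) fun _ _ _ => Nat.zero_le _
      _ = deg (Lf x) := (deg_eq_sum (Lf x)).symm
      _ ≤ m := hLdeg x
  have hslices : (Img.image slc).card ≤ 2 ^ (2 * m + 2) := by
    have hsub : Img.image slc ⊆ ((Finset.univ : Finset ↥S).image Lr).image G := by
      intro b hb
      rw [Finset.mem_image] at hb
      obtain ⟨x, hx, rfl⟩ := hb
      rw [hImg, Finset.mem_image] at hx
      obtain ⟨y, -, rfl⟩ := hx
      rw [hslcG y]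
      exact Finset.mem_image_of_mem G (Finset.mem_image_of_mem Lr (Finset.mem_univ y))
    calc (Img.image slc).card ≤ (((Finset.univ : Finset ↥S).image Lr).image G).card := Finset.card_le_card hsub
      _ ≤ ((Finset.univ : Finset ↥S).image Lr).card := Finset.card_image_le
      _ ≤ 2 ^ (m + T.card) := card_le_of_supported T m _ hLrF
      _ ≤ 2 ^ (2 * m + 2) := Nat.pow_le_pow_right (by norm_num) (by omega)
  -- the fibres over the slices
  have hfst : ∀ x ∈ Img, slc x ∈ Img.image slc := fun x hx => Finset.mem_image_of_mem slc hx
  have hfib : ∀ b ∈ Img.image slc, (Img.filter fun x => slc x = b).card ≤ sliceBdO m (sE u v) := by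
    intro b hb
    obtain ⟨x1, hx1, hx1b⟩ := Finset.mem_image.mp hb
    rw [hImg, Finset.mem_image] at hx1
    obtain ⟨y1, -, rfl⟩ := hx1
    have hbsum : sB Do.idx b ≤ m * m * (m + 1) := by
      have h := sB_piT_le Do.idx hqm hpm hBm (Lf y1) (hLdeg y1)
      rw [hLpi y1] at h
      have e : sB Do.idx b = sB Do.idx ⇑(xf y1) :=
        Finset.sum_congr rfl fun j hj => by rw [← hx1b, ← hslcB _ j hj]
      rw [e]; exact h
    set Sb : Finset (Fin (sE u v) → ℕ) := (Img.filter fun x => slc x = b).image fun x => ⇑(xhat Do.idx x) with hSb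
    have hcardb : (Img.filter fun x => slc x = b).card = Sb.card := by
      rw [hSb, Finset.card_image_of_injOn]
      intro x hx x' hx' hxx
      have h1 := Finset.mem_filter.mp (Finset.mem_coe.mp hx)
      have h2 := Finset.mem_filter.mp (Finset.mem_coe.mp hx')
      rw [hImg, Finset.mem_image] at h1 h2
      obtain ⟨⟨y, -, rfl⟩, hyb⟩ := h1
      obtain ⟨⟨y', -, rfl⟩, hyb'⟩ := h2
      have hBB : ∀ j ∈ B Do.idx, (xf y) j = (xf y') j := fun j hj => by
        rw [hslcB _ j hj, hslcB _ j hj, hyb, hyb']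
      simp only at hxx
      rw [← xOf_xhat Do.idx (xf y) (hxa y), ← xOf_xhat Do.idx (xf y') (hxa y'), xOf_congr Do.idx hBB, hxx]
    rw [hcardb]
    refine Do.sliceCount b hbsum U V Sb fun μ hμ => ?_
    obtain ⟨x, hx, rfl⟩ := Finset.mem_image.mp hμ
    obtain ⟨hxI, hxb⟩ := Finset.mem_filter.mp hx
    rw [hImg, Finset.mem_image] at hxI
    obtain ⟨y, -, rfl⟩ := hxI
    have hFb : Fsl Do.idx (cU u v) (cV u v) b = Fsl Do.idx (cU u v) (cV u v) ⇑(xf y) :=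
      (Fsl_congr Do.idx (cU u v) (cV u v) fun j hj => by rw [hslcB _ j hj, hxb]).symm
    rw [hFb]
    refine ⟨hxF y, cf y, fun ν hν hFν => ?_⟩
    have hlt := hxmin y ν hν hFν
    rw [hsumUV y, hsumUV y ν]
    exact div_lt_div_of_pos_right hlt (hrpos y)
  rw [← hcard, Finset.card_eq_sum_card_fiberwise hfst]
  calc ∑ b ∈ Img.image slc, (Img.filter fun x => slc x = b).card
      ≤ ∑ _b ∈ Img.image slc, sliceBdO m (sE u v) := Finset.sum_le_sum hfib
    _ = (Img.image slc).card * sliceBdO m (sE u v) := by rw [Finset.sum_const, smul_eq_mul]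
    _ ≤ 2 ^ (2 * m + 2) * sliceBdO m (sE u v) := Nat.mul_le_mul_right _ hslices

end FreeCount

end R8
end Summit.ValiantsHypothesis.ValiantsHypothesis.Theorems.NewtonUnitEquations.TwoProducts.PermutationType

end
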